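import Literature.Algebra.Homology.FibreEulerCharacteristic
import Mathlib.Algebra.Homology.Embedding.CochainComplex
import HarnessLib

/-!
# The fibre Euler characteristic of a bounded `ℤ`-indexed cochain complex of finite projective modules is locally constant
# (Görtz–Wedhorn II, Prop. 23.117 (3); EGA III 7.9.4) — the `ℤ` ∕ `IsStrictlyGE`–`IsStrictlyLE` form of row
# `FibreEulerCharacteristic`

Layer `Literature/Algebra/Homology` (theorems only — no definition, named fact, instance, notation, `sorry`; Mathlib + ★
`Algebra/Homology/FibreEulerCharacteristic`). Row ★ (180) proves Görtz–Wedhorn II Prop. 23.117 (3) («Suppose that `E` is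
perfect. Then the Euler characteristic `χ_E : S → ℤ` is locally constant on `S`», held PDF p0466) for `ℕ`-indexed cochain
complexes `K` of finite projective modules with `K^{n+1} = 0`, and lists under «What is NOT here»: «`ℤ`-indexed or unbounded
complexes (apply to a bounded window of degrees after shifting)». The complexes the tree actually produces are `ℤ`-indexed:
Mathlib `CochainComplex (ModuleCat A) ℤ` with the boundedness predicates `IsStrictlyGE a` ∕ `IsStrictlyLE b` (★
`Algebra/Homology/StrictlyPerfectVanishingBaseChange`, ★ `PerfectOfPseudoCoherent.exists_strictlyPerfect_quasiIso_of_flat`: `P.IsStrictlyLE r ∧ ∀ n,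
Finite ∧ Projective (P.X n)`). This file does the shift once and for all, WITHOUT shifting the complex: for `K : CochainComplex
(ModuleCat A) ℤ` of finite projective modules with `K^{a−1} = 0` and `K^{a+n+1} = 0` (instances `Subsingleton`, or `[K.IsStrictlyGE
a] [K.IsStrictlyLE (a + n)]`), at every prime `𝔭`

  `Σ_{j ≤ n} (−1)ʲ dim_{κ(𝔭)} H^{a+j}(K ⊗ κ(𝔭)) = Σ_{j ≤ n} (−1)ʲ rankAtStalk K^{a+j} 𝔭`,

hence `𝔭 ↦ χ(K ⊗ κ(𝔭))` (up to the global sign `(−1)ᵃ`) is LOCALLY CONSTANT. The fibre Betti numbers are realised as in rows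
173 ∕ 174 ∕ 180 (`dim_κ ((ker (dⁱ ⊗ κ)).map (range (d^{i−1} ⊗ κ)).mkQ)`, `dⁱ = (K.d i (i+1)).hom`, base change `LinearMap.baseChange
κ(𝔭)`); the arithmetic is row 180 §1 `alternatingSum_betti_eq_alternatingSum_rank` BY NAME on the re-indexed sequences `j ↦
b(a + j)`, `j ↦ rk K^{a+j}`, `j ↦ dim(κ ⊗ coker d^{a+j−1})`, the counts are row 174 `finrank_homology_baseChange_add_rankAtStalk` BY
NAME at the windows `(a + j − 1, a + j, a + j + 1)`; the only work here is the `ℤ`-degree bookkeeping (`a + ↑(j+1) = a + ↑j +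
1` inside `K.X _` ∕ `K.d _ _`, by `rw` on integer identities whose motives are type-correct because `K.d i j` is defined for
ALL pairs `(i, j)`), the two boundary computations, and the `IsStrictlyGE ∕ IsStrictlyLE` dress (Mathlib
`CochainComplex.isZero_of_isStrictlyGE ∕ LE` + `ModuleCat.isZero_iff_subsingleton`).

* `finrank_residueField_tensor_coker_eq_rankAtStalk_of_subsingleton` — `K^{i−1} = 0 ⇒ dim(κ ⊗ coker d^{i−1}) = rankAtStalk Kⁱ`;
  `finrank_residueField_tensor_coker_eq_zero_of_subsingleton_int` — `Kⁱ = 0 ⇒` both counts at `i` vanish;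
  `finrank_homology_baseChange_add_rankAtStalk_int` — the window count at `(a + j − 1, a + j, a + j + 1)` re-indexed to `j + 1`;
* **`alternatingSum_finrank_homology_baseChange_eq_int`** and **`isLocallyConstant_alternatingSum_finrank_homology_baseChange_int`**
  (`Subsingleton` hypotheses); `…_of_isStrictlyGE_of_isStrictlyLE` (both, boundedness-predicate dress).

Against the kin, BY DECL: row 180 (the `ℕ` case and the arithmetic — engines BY NAME, not re-proved), row 174 (the count, BY
NAME), ★ `StrictlyPerfectVanishingBaseChange` (same dialect `CochainComplex (ModuleCat R) ℤ`, `(K.d i (i+1)).hom`, `Subsingleton (K.X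
(m+1))`, `IsStrictlyLE`; vanishing-line exchange, not χ), rows `EulerCharacteristicBaseChange` ∕ `EulerPoincareRank` ∕
`EulerCharacteristicTotalComplex` (χ of complexes of FREE modules read in a field ∕ over rank–nullity rings: `χ_H(K ⊗ C) = χ(C)`
constant outright — no `Spec`, no projective terms). Nearest prior art BY DECL: ★ `EulerCharacteristicBaseChange.
homologyEulerChar_extendScalars` — for complexes of finitely generated FREE modules with finite rank support that row gives the
fibre Euler characteristic CONSTANT (`= Σ (−1)ⁱ rank`) in Mathlib's `HomologicalComplex.eulerChar` dialect over any field-valued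
ring map (and ★ `EulerCharacteristicShift.homologyEulerChar_shift` is the `n.negOnePow` sign rule the «global sign `(−1)ᵃ`» remark
below parallels); here PROJECTIVE terms, `rankAtStalk`, the window realisation of rows 174 ∕ 180, LOCAL constancy on `Spec A`. Mathlib used (pin): `CochainComplex.isZero_of_isStrictlyGE ∕ _LE`,
`ModuleCat.isZero_iff_subsingleton`, `Module.rankAtStalk_eq_zero_of_subsingleton`, `Submodule.quotEquivOfEqBot`,
`Module.isLocallyConstant_rankAtStalk`. What is NOT here: the identification with Mathlib's `HomologicalComplex.eulerChar` of the
base-changed complex in the `extendScalars` dialect; unbounded complexes; the `Int.negOnePow`-weighted sum over `Finset.Icc a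
b` (differs by the sign `(−1)ᵃ`). Library only (cell `pub-hodge-ring2`, count-neutral); proves nothing about any crux, route
or conjecture.

## References

* U. Görtz, T. Wedhorn, *Algebraic Geometry II: Cohomology of Schemes* (2023), Prop. 23.117 (3) and proof (p. 466; held PDF
  p0466). [GortzWedhorn2023]
* D. Mumford, *Abelian Varieties* (1970), §5 Cor. (b) (p. 50) — not held at this pin; statement as cited by the kin rows.
  [MumfordAV1970]
* A. Grothendieck, EGA III₂ (1963), 7.9.4 — not held at this pin; cited in prose. [EGAIII2]
-/

universe u

open TensorProduct Module

namespace Literature.Algebra.Homology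

section Complex

variable {A : Type u} [CommRing A] (K : CochainComplex (ModuleCat.{u} A) ℤ)
  [∀ i, Module.Finite A (K.X i)] [∀ i, Module.Projective A (K.X i)]

/-- Below the bottom: if `K^{i−1} = 0` then `d^{i−1} = 0` and the «cokernel of the incoming differential» at `i` is `Kⁱ` itself,
of fibre rank `rankAtStalk Kⁱ` (Mathlib `Module.rankAtStalk_eq`). [cite: GortzWedhorn2023, Prop. 23.117 (3), proof (p. 466)] -/
theorem finrank_residueField_tensor_coker_eq_rankAtStalk_of_subsingleton (i : ℤ) [Subsingleton (K.X (i - 1))]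
    (p : PrimeSpectrum A) :
    finrank p.asIdeal.ResidueField (p.asIdeal.ResidueField ⊗[A] (K.X i ⧸ LinearMap.range (K.d (i - 1) i).hom)) =
      Module.rankAtStalk (K.X i) p := by
  have hbot : LinearMap.range (K.d (i - 1) i).hom = ⊥ := by
    rw [LinearMap.range_eq_bot, LinearMap.ext_iff]
    intro x
    rw [Subsingleton.elim x 0, map_zero, LinearMap.zero_apply]
  let e : (K.X i ⧸ LinearMap.range (K.d (i - 1) i).hom) ≃ₗ[A] K.X i := Submodule.quotEquivOfEqBot _ hbot
  rw [(e.baseChange A p.asIdeal.ResidueField _ _).finrank_eq, Module.rankAtStalk_eq]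

omit [∀ i, Module.Finite A (K.X i)] [∀ i, Module.Projective A (K.X i)] in
/-- Beyond the top: if `Kⁱ = 0` then its rank and the fibre rank of `coker(d^{i−1} : K^{i−1} → Kⁱ)` vanish (row 180's
`finrank_residueField_tensor_coker_eq_zero_of_subsingleton`, `ℤ`-indexed). [cite: GortzWedhorn2023, Prop. 23.117 (3), proof (p.
466)] -/
theorem finrank_residueField_tensor_coker_eq_zero_of_subsingleton_int (i : ℤ) [Subsingleton (K.X i)] (p : PrimeSpectrum A) :
    finrank p.asIdeal.ResidueField (p.asIdeal.ResidueField ⊗[A] (K.X i ⧸ LinearMap.range (K.d (i - 1) i).hom)) = 0 ∧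
      Module.rankAtStalk (K.X i) p = 0 := by
  refine ⟨?_, by rw [Module.rankAtStalk_eq_zero_of_subsingleton]; rfl⟩
  haveI : Subsingleton (p.asIdeal.ResidueField ⊗[A] (K.X i ⧸ LinearMap.range (K.d (i - 1) i).hom)) := by
    refine ⟨fun x y => ?_⟩
    have hx : ∀ z : p.asIdeal.ResidueField ⊗[A] (K.X i ⧸ LinearMap.range (K.d (i - 1) i).hom), z = 0 := fun z => by
      induction z using TensorProduct.induction_on with
      | zero => rfl
      | tmul c m => rw [Subsingleton.elim m 0, tmul_zero]
      | add a b ha hb => rw [ha, hb, add_zero]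
    rw [hx x, hx y]
  exact Module.finrank_zero_of_subsingleton

/-- The window count of row 174 `finrank_homology_baseChange_add_rankAtStalk` at the `ℤ`-window `(a + j − 1, a + j, a + j + 1)`,
with the top degree RE-INDEXED as `a + ↑(j + 1)` (the `ℤ`-degree bookkeeping: `a + ↑(j+1) = a + ↑j + 1` and `a + ↑(j+1) − 1
= a + ↑j` rewritten inside `K.X _` ∕ `K.d _ _`). [cite: GortzWedhorn2023, Prop. 23.117 (3), proof (p. 466)] -/
theorem finrank_homology_baseChange_add_rankAtStalk_int (a : ℤ) (j : ℕ) (p : PrimeSpectrum A) :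
    finrank p.asIdeal.ResidueField ((LinearMap.ker ((K.d (a + j) (a + j + 1)).hom.baseChange p.asIdeal.ResidueField)).map
        (LinearMap.range ((K.d (a + j - 1) (a + j)).hom.baseChange p.asIdeal.ResidueField)).mkQ) +
        Module.rankAtStalk (K.X (a + (j + 1 : ℕ))) p =
      finrank p.asIdeal.ResidueField (p.asIdeal.ResidueField ⊗[A] (K.X (a + j) ⧸ LinearMap.range (K.d (a + j - 1) (a + j)).hom)) +
        finrank p.asIdeal.ResidueField (p.asIdeal.ResidueField ⊗[A]
          (K.X (a + (j + 1 : ℕ)) ⧸ LinearMap.range (K.d (a + (j + 1 : ℕ) - 1) (a + (j + 1 : ℕ))).hom)) := by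
  have e2 : a + ((j + 1 : ℕ) : ℤ) - 1 = a + j := by push_cast; ring
  have e1 : a + ((j + 1 : ℕ) : ℤ) = a + j + 1 := by push_cast; ring
  rw [e2, e1]
  exact finrank_homology_baseChange_add_rankAtStalk K (a + j - 1) (a + j) (a + j + 1) p

/-- **The fibre Euler characteristic equals the alternating sum of the ranks, `ℤ`-indexed** (Görtz–Wedhorn II, proof of Prop.
23.117 (3): «the dimensions of the cokernels cancel»; EGA III 7.9.4): for a `ℤ`-cochain complex `K` of finite projective modules
over ANY commutative ring with `K^{a−1} = 0` and `K^{a+n+1} = 0`, at every prime `𝔭`, `Σ_{j ≤ n} (−1)ʲ dim_{κ(𝔭)} H^{a+j}(K ⊗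
κ(𝔭)) = Σ_{j ≤ n} (−1)ʲ rankAtStalk K^{a+j} 𝔭` (row 180 §1 `alternatingSum_betti_eq_alternatingSum_rank` on the re-indexed
sequences). Degrees outside `[a − 1, a + n + 1]` do not enter. [cite: GortzWedhorn2023, Prop. 23.117 (3) (p. 466)] -/
theorem alternatingSum_finrank_homology_baseChange_eq_int (a : ℤ) (n : ℕ) [Subsingleton (K.X (a - 1))]
    [Subsingleton (K.X (a + n + 1))] (p : PrimeSpectrum A) :
    ∑ j ∈ Finset.range (n + 1), (-1 : ℤ) ^ j *
        (finrank p.asIdeal.ResidueField ((LinearMap.ker ((K.d (a + j) (a + j + 1)).hom.baseChange p.asIdeal.ResidueField)).map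
          (LinearMap.range ((K.d (a + j - 1) (a + j)).hom.baseChange p.asIdeal.ResidueField)).mkQ) : ℤ) =
      ∑ j ∈ Finset.range (n + 1), (-1 : ℤ) ^ j * (Module.rankAtStalk (K.X (a + j)) p : ℤ) := by
  -- the boundary instances at the re-indexed degrees `a + ↑0 − 1` and `a + ↑(n + 1)`
  haveI h0 : Subsingleton (K.X (a + ((0 : ℕ) : ℤ) - 1)) := by rw [Nat.cast_zero, add_zero]; infer_instance
  haveI htop : Subsingleton (K.X (a + ((n + 1 : ℕ) : ℤ))) := by
    rw [show a + ((n + 1 : ℕ) : ℤ) = a + n + 1 by push_cast; ring]; infer_instance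
  refine alternatingSum_betti_eq_alternatingSum_rank _ (fun j => Module.rankAtStalk (K.X (a + j)) p)
    (fun j => finrank p.asIdeal.ResidueField
      (p.asIdeal.ResidueField ⊗[A] (K.X (a + j) ⧸ LinearMap.range (K.d (a + j - 1) (a + j)).hom)))
    (finrank_residueField_tensor_coker_eq_rankAtStalk_of_subsingleton K _ p) (fun j => ?_) n
    (finrank_residueField_tensor_coker_eq_zero_of_subsingleton_int K _ p).1
    (finrank_residueField_tensor_coker_eq_zero_of_subsingleton_int K _ p).2
  exact finrank_homology_baseChange_add_rankAtStalk_int K a j p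

/-- **The fibre Euler characteristic is LOCALLY CONSTANT on `Spec A`, `ℤ`-indexed** (Görtz–Wedhorn II, Prop. 23.117 (3);
Mumford, *Abelian Varieties*, §5 Cor. (b)): for a `ℤ`-cochain complex of finite projective modules with `K^{a−1} = 0 = K^{a+n+1}`,
`𝔭 ↦ Σ_{j ≤ n} (−1)ʲ dim_{κ(𝔭)} H^{a+j}(K ⊗ κ(𝔭))` is locally constant (it is `Σ (−1)ʲ rankAtStalk K^{a+j}`, Mathlib
`Module.isLocallyConstant_rankAtStalk`). [cite: GortzWedhorn2023, Prop. 23.117 (3) (p. 466)] [cite: MumfordAV1970, §5 Cor. (b) (p.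
50)] -/
theorem isLocallyConstant_alternatingSum_finrank_homology_baseChange_int (a : ℤ) (n : ℕ) [Subsingleton (K.X (a - 1))]
    [Subsingleton (K.X (a + n + 1))] :
    IsLocallyConstant fun p : PrimeSpectrum A => ∑ j ∈ Finset.range (n + 1), (-1 : ℤ) ^ j *
      (finrank p.asIdeal.ResidueField ((LinearMap.ker ((K.d (a + j) (a + j + 1)).hom.baseChange p.asIdeal.ResidueField)).map
        (LinearMap.range ((K.d (a + j - 1) (a + j)).hom.baseChange p.asIdeal.ResidueField)).mkQ) : ℤ) := by
  have heq : (fun p : PrimeSpectrum A => ∑ j ∈ Finset.range (n + 1), (-1 : ℤ) ^ j *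
      (finrank p.asIdeal.ResidueField ((LinearMap.ker ((K.d (a + j) (a + j + 1)).hom.baseChange p.asIdeal.ResidueField)).map
        (LinearMap.range ((K.d (a + j - 1) (a + j)).hom.baseChange p.asIdeal.ResidueField)).mkQ) : ℤ)) =
      fun p => ∑ j ∈ Finset.range (n + 1), (-1 : ℤ) ^ j * (Module.rankAtStalk (K.X (a + j)) p : ℤ) :=
    funext fun p => alternatingSum_finrank_homology_baseChange_eq_int K a n p
  rw [heq]
  have hlc : ∀ i, IsLocallyConstant (Module.rankAtStalk (R := A) (K.X i)) := fun i => by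
    haveI := Module.finitePresentation_of_projective A (K.X i)
    exact Module.isLocallyConstant_rankAtStalk
  refine (IsLocallyConstant.iff_exists_open _).2 fun p => ?_
  refine ⟨⋂ j ∈ Finset.range (n + 1),
      {q : PrimeSpectrum A | Module.rankAtStalk (K.X (a + j)) q = Module.rankAtStalk (K.X (a + j)) p},
    isOpen_biInter_finset fun j _ => (hlc _).isOpen_fiber _, by simp, fun q hq => ?_⟩
  simp only [Set.mem_iInter, Set.mem_setOf_eq] at hq
  exact Finset.sum_congr rfl fun j hj => by rw [hq j hj]

/-- The same identity in the `IsStrictlyGE ∕ IsStrictlyLE` dress of Mathlib's boundedness predicates (the output shape of ★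
`PerfectOfPseudoCoherent.exists_strictlyPerfect_quasiIso_of_flat`): `K` concentrated in degrees `[a, a + n]`. [cite: GortzWedhorn2023,
Prop. 23.117 (3) (p. 466)] -/
theorem alternatingSum_finrank_homology_baseChange_eq_of_isStrictlyGE_of_isStrictlyLE (a : ℤ) (n : ℕ) [K.IsStrictlyGE a]
    [K.IsStrictlyLE (a + n)] (p : PrimeSpectrum A) :
    ∑ j ∈ Finset.range (n + 1), (-1 : ℤ) ^ j *
        (finrank p.asIdeal.ResidueField ((LinearMap.ker ((K.d (a + j) (a + j + 1)).hom.baseChange p.asIdeal.ResidueField)).map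
          (LinearMap.range ((K.d (a + j - 1) (a + j)).hom.baseChange p.asIdeal.ResidueField)).mkQ) : ℤ) =
      ∑ j ∈ Finset.range (n + 1), (-1 : ℤ) ^ j * (Module.rankAtStalk (K.X (a + j)) p : ℤ) := by
  haveI : Subsingleton (K.X (a - 1)) := ModuleCat.isZero_iff_subsingleton.mp (K.isZero_of_isStrictlyGE a (a - 1) (by omega))
  haveI : Subsingleton (K.X (a + n + 1)) :=
    ModuleCat.isZero_iff_subsingleton.mp (K.isZero_of_isStrictlyLE (a + n) (a + n + 1) (by omega))
  exact alternatingSum_finrank_homology_baseChange_eq_int K a n p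

/-- **Görtz–Wedhorn II Prop. 23.117 (3), `IsStrictlyGE ∕ IsStrictlyLE` dress**: for a cochain complex of finite projective
modules concentrated in degrees `[a, a + n]`, the fibre Euler characteristic `𝔭 ↦ Σ_{j ≤ n} (−1)ʲ dim H^{a+j}(K ⊗ κ(𝔭))` is locally
constant on `Spec A`. [cite: GortzWedhorn2023, Prop. 23.117 (3) (p. 466)] [cite: MumfordAV1970, §5 Cor. (b) (p. 50)] -/
theorem isLocallyConstant_alternatingSum_finrank_homology_baseChange_of_isStrictlyGE_of_isStrictlyLE (a : ℤ) (n : ℕ)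
    [K.IsStrictlyGE a] [K.IsStrictlyLE (a + n)] :
    IsLocallyConstant fun p : PrimeSpectrum A => ∑ j ∈ Finset.range (n + 1), (-1 : ℤ) ^ j *
      (finrank p.asIdeal.ResidueField ((LinearMap.ker ((K.d (a + j) (a + j + 1)).hom.baseChange p.asIdeal.ResidueField)).map
        (LinearMap.range ((K.d (a + j - 1) (a + j)).hom.baseChange p.asIdeal.ResidueField)).mkQ) : ℤ) := by
  haveI : Subsingleton (K.X (a - 1)) := ModuleCat.isZero_iff_subsingleton.mp (K.isZero_of_isStrictlyGE a (a - 1) (by omega))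
  haveI : Subsingleton (K.X (a + n + 1)) :=
    ModuleCat.isZero_iff_subsingleton.mp (K.isZero_of_isStrictlyLE (a + n) (a + n + 1) (by omega))
  exact isLocallyConstant_alternatingSum_finrank_homology_baseChange_int K a n

end Complex

end Literature.Algebra.Homology
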